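import Mathlib
import Summits.AtomisticToContinuum.Crystallization.Theses.PhononSlackCertificates
import Summits.AtomisticToContinuum.Crystallization.Theorems.PhononSlackCertificatesNearFarGlueRHcpShell
import Summits.AtomisticToContinuum.Crystallization.Theorems.EnergyDerivativeOrderLimitTransferHcpShells
import Literature.MathematicalPhysics.StatisticalMechanics.BarlowCoordination
import Literature.MathematicalPhysics.StatisticalMechanics.HcpHomogeneous
import Literature.Geometry.DiscreteGeometry.LayerShellPatterns
import Literature.Geometry.DiscreteGeometry.TwoShellPatterns

/-!
# Crux `PhononSlackCertificates.NearFarGlueR` (stmt-AtomisticToContinuum-14970), line `Sketch`: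
two-shell geometry of the RELAXED hexagonal close packing — a bad particle owns a vacant site

Continuation lead c2; part 1 of 2 of the relaxed (box) version of the hcp lattice-subset
coercivity theorem (`PhononSlackCertificatesNearFarGlueRHcpBoxSubset.lean`).  The ideal version
(`…HcpShell.lean` / `…HcpSubset.lean`) needs `h² = ⅔a²`; the conjectured Lennard-Jones ground state
is hcp with a slightly NON-ideal axial ratio, and the route measures layered-ness against the box of
interlayer spacings `h ∈ [39a/50, 17a/20]` (`NearFieldConvexity`, `LayeredWindows`).  For the stacking
`hcpStacking a h` with `a > 0` and ANY `h` in that box: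

* `exists_hcpTwoShellInt_of_norm_le_box` — every non-zero stacking point of norm `≤ 3a/2` has layer
  coordinates `(k, i, j)` among the eighteen two-shell triples (integer form of the ideal case,
  reached because `h ≥ 39a/50` keeps the layers `±2` beyond `3a/2` and the distance form below `28`);
* `dist_barlowPos_layer` — the actual site `barlowPos a h … k i j` and the ideal one (spacing
  `√(2/3)·a`, the image `a • A₁ v` of a pattern point under the close-packing frame) differ by
  `|k|·|h − √(2/3)·a| ≤ a/20` in the box (`abs_sub_ideal_le`);
* `hcp_twoShell_sites_box` — around every point `p` (homogeneity `hcpStacking_homogeneous`) there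
  are a linear isometry `A` and eighteen stacking sites, `a/20`-close to `p + a • A v`
  (`v ∈ hcpTwoShellPattern`), exhausting the stacking points within `3a/2` of `p`;
* `good_of_sites_occupied_hcp_box` — so a particle of a sub-configuration all of whose eighteen
  sites are occupied is `1/20`-good (an `a/20`-match, no longer exact), and (`stub_hcpBoxShell`,
  registered sub-goal of the crux item) a BAD particle has a vacant stacking site within
  `(1/20 + √2)·a` of it; `le_dist_of_mem_hcpStacking_box` — the relaxed stacking is
  `24a/25`-separated.
-/

noncomputable section

namespace Summit.AtomisticToContinuum.Crystallization.Theorems.PhononSlackCertificatesNearFarGlueR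

open Literature.MathematicalPhysics.StatisticalMechanics
open Literature.Geometry.DiscreteGeometry
open Summit.AtomisticToContinuum.Crystallization.Theorems.EnergyDerivativeOrderLimitTransfer
  (twelve_mul_dist_sq dist_sq_cases_of_mem)
open scoped BigOperators

/-! ## §6 Classification of the close stacking points in the box of spacings -/

/-- **Every non-zero point of the relaxed stacking of norm `≤ 3a/2` is one of the eighteen
two-shell sites** (`a > 0`, `h ≥ 39a/50`): its layer coordinates `(k, i, j)` satisfy `k² ≤ 1` and
come from the integer model of the hcp two-shell pattern.  Integer form:
`12‖q‖² = a²·F₀ + 12k²h²` with `F₀ = 3(2i+j+L)² + (3j+L)²`; `h ≥ 39a/50` forces `|k| ≤ 1` and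
`F₀ + 8k² ≤ 27`, the hypothesis of `exists_hcpTwoShellInt_of_form_le`. [folklore] -/
theorem exists_hcpTwoShellInt_of_norm_le_box {a h : ℝ} (ha : 0 < a) (hlo : 39 / 50 * a ≤ h)
    {k i j : ℤ} (hne : (k, i, j) ≠ (0, 0, 0))
    (hle : ‖barlowPos a h alternatingHagg k i j‖ ≤ 3 / 2 * a) :
    k ^ 2 ≤ 1 ∧ ∃ t ∈ hcpInt ∪ hcpSecondShellInt,
      t 0 + t 1 + t 2 = 6 * k ∧ -(t 0 - t 1) = 6 * i + 3 * j + 3 * k ^ 2 ∧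
        -(t 0 + t 1 - 2 * t 2) = 9 * j + 3 * k ^ 2 := by
  have h12 := twelve_mul_dist_sq (a := a) (h := h) alternatingHagg 0 0 0 k i j
  have h00 : barlowPos a h alternatingHagg 0 0 0 = 0 := by simp [barlowPos]
  rw [h00, dist_comm, dist_zero_right, haggLabel_zero] at h12
  set L : ℤ := haggLabel alternatingHagg k with hLdef
  set F : ℤ := 3 * (2 * (0 - i) + (0 - j) + (0 - L)) ^ 2 + (3 * (0 - j) + (0 - L)) ^ 2 with hFdef
  have hF0 : (0 : ℝ) ≤ F := by positivity
  have ha2 : 0 < a ^ 2 := by positivity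
  have hh2 : (39 / 50 * a) ^ 2 ≤ h ^ 2 := pow_le_pow_left₀ (by positivity) hlo 2
  have hn2 : ‖barlowPos a h alternatingHagg k i j‖ ^ 2 ≤ (3 / 2 * a) ^ 2 :=
    pow_le_pow_left₀ (norm_nonneg _) hle 2
  have hK : (((0 - k) ^ 2 : ℤ) : ℝ) = (k : ℝ) ^ 2 := by push_cast; ring
  rw [hK] at h12
  -- the layer is `−1, 0, 1`
  have hk4r : (k : ℝ) ^ 2 < 4 := by nlinarith
  have hk4 : k ^ 2 < 2 ^ 2 := by exact_mod_cast (show ((k ^ 2 : ℤ) : ℝ) < 4 by push_cast; exact hk4r)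
  obtain ⟨hk1, hk2⟩ := abs_lt_of_sq_lt_sq' hk4 (by norm_num)
  have hk : k ^ 2 ≤ 1 := by nlinarith
  have hL : L = k ^ 2 := haggLabel_alternating_of_sq_le_one hk
  -- the form bound `F + 8k² ≤ 27` (real bound `< 28`)
  have hkr : (k : ℝ) ^ 2 ≤ 1 := by exact_mod_cast hk
  have hFr : (F : ℝ) + 8 * (k : ℝ) ^ 2 < 28 := by nlinarith
  have hF8 : F + 8 * k ^ 2 ≤ 27 := by
    have : ((F + 8 * k ^ 2 : ℤ) : ℝ) < 28 := by push_cast; exact hFr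
    have h' : F + 8 * k ^ 2 < 28 := by exact_mod_cast this
    omega
  refine exists_hcpTwoShellInt_of_form_le hne ?_
  rw [hFdef, hL] at hF8
  nlinarith

/-- **The relaxed stacking is `24a/25`-separated** (`a > 0`, `h ≥ 39a/50`): distinct points are at
distance `≥ √(a²/3 + h²) ∧ a ≥ (24/25)·a` (by `dist_sq_cases_of_mem`: the realised squared distances
are `a²`, `a²/3 + h²` or at least `3a²`, `4a²/3 + h²`, `4h²`). [folklore] -/
theorem le_dist_of_mem_hcpStacking_box {a h : ℝ} (ha : 0 < a) (hlo : 39 / 50 * a ≤ h)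
    {p q : EuclideanSpace ℝ (Fin 3)} (hp : p ∈ hcpStacking a h) (hq : q ∈ hcpStacking a h)
    (hpq : p ≠ q) : 24 / 25 * a ≤ dist p q := by
  have hh2 : (39 / 50 * a) ^ 2 ≤ h ^ 2 := pow_le_pow_left₀ (by positivity) hlo 2
  have hd2 : (24 / 25 * a) ^ 2 ≤ dist p q ^ 2 := by
    rcases dist_sq_cases_of_mem (a := a) (h := h) isHaggSeq_alternating hp hq hpq with
      hd | hd | hd | hd | hd
    · rw [hd]; nlinarith
    · rw [hd]; nlinarith
    · nlinarith
    · nlinarith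
    · nlinarith
  exact (pow_le_pow_iff_left₀ (by positivity) dist_nonneg two_ne_zero).1 hd2

/-- Distinct layer coordinates give distinct points (`a, h > 0`). [folklore] -/
theorem barlowPos_injective_coords {a h : ℝ} (ha : 0 < a) (h0 : 0 < h) (s : ℤ → ℤ)
    {k i j k' i' j' : ℤ} (heq : barlowPos a h s k i j = barlowPos a h s k' i' j') :
    (k, i, j) = (k', i', j') := by
  by_contra hne
  have hle := le_dist_barlowPos a h s ha.le h0.le hne
  rw [heq, dist_self] at hle
  have : 0 < min a h := lt_min ha h0
  linarith

/-- **Actual versus ideal site**: the points with the same layer coordinates in the stackings of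
spacings `h` and `h'` differ by `|k|·|h − h'|` (a vertical shift of the layer `k`). [folklore] -/
theorem dist_barlowPos_layer (a h h' : ℝ) (s : ℤ → ℤ) (k i j : ℤ) :
    dist (barlowPos a h s k i j) (barlowPos a h' s k i j) = |(k : ℝ)| * |h - h'| := by
  rw [EuclideanSpace.dist_eq, Fin.sum_univ_three, Real.dist_eq, Real.dist_eq, Real.dist_eq,
    barlowPos_apply_zero, barlowPos_apply_zero, barlowPos_apply_one, barlowPos_apply_one,
    barlowPos_apply_two, barlowPos_apply_two]
  have h1 : (k : ℝ) * h - k * h' = k * (h - h') := by ring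
  rw [sub_self, sub_self, h1, abs_zero]
  simp only [ne_eq, OfNat.ofNat_ne_zero, not_false_eq_true, zero_pow, zero_add, sq_abs]
  rw [Real.sqrt_sq_eq_abs, abs_mul]

/-- The ideal spacing `√(2/3)·a` lies in `[0.8164·a, 0.8167·a]` (`a ≥ 0`). [folklore] -/
theorem sqrt_two_thirds_bounds : (0.8164 : ℝ) ≤ Real.sqrt (2 / 3) ∧ Real.sqrt (2 / 3) ≤ 0.8167 := by
  constructor
  · rw [show (0.8164 : ℝ) = Real.sqrt (0.8164 ^ 2) from (Real.sqrt_sq (by norm_num)).symm]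
    exact Real.sqrt_le_sqrt (by norm_num)
  · rw [show (0.8167 : ℝ) = Real.sqrt (0.8167 ^ 2) from (Real.sqrt_sq (by norm_num)).symm]
    exact Real.sqrt_le_sqrt (by norm_num)

/-- **The box is within tolerance of the ideal spacing**: `h ∈ [39a/50, 17a/20]`, `a ≥ 0` give
`|h − √(2/3)·a| ≤ a/20`. [folklore] -/
theorem abs_sub_ideal_le {a h : ℝ} (ha : 0 ≤ a) (hlo : 39 / 50 * a ≤ h) (hhi : h ≤ 17 / 20 * a) :
    |h - Real.sqrt (2 / 3) * a| ≤ a / 20 := by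
  obtain ⟨h1, h2⟩ := sqrt_two_thirds_bounds
  rw [abs_le]
  constructor <;> nlinarith

/-- The ideal spacing is positive and squares to `⅔a²` (`a > 0`). [folklore] -/
theorem ideal_spacing_pos_sq {a : ℝ} (ha : 0 < a) :
    0 < Real.sqrt (2 / 3) * a ∧ (Real.sqrt (2 / 3) * a) ^ 2 = 2 / 3 * a ^ 2 := by
  refine ⟨by positivity, ?_⟩
  rw [mul_pow, Real.sq_sqrt (by norm_num)]

/-! ## §7 The two-shell sites of an arbitrary point of the relaxed stacking -/

/-- **The two-shell sites of any point of the relaxed hcp stacking.**  For `a > 0`,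
`h ∈ [39a/50, 17a/20]` and every point `p` of `hcpStacking a h` there are a linear isometry `A`
and a site map `site` such that: for each of the eighteen pattern points `v`, `site v` is a
stacking point other than `p`, within `a/20` of the ideal position `p + a • A v`; `site` is
injective on the pattern; and every stacking point other than `p` within `3a/2` of `p` is a site.
(Homogeneity carries the sites of the origin — actual `barlowPos a h … k i j` versus ideal
`barlowPos a (√(2/3)a) … k i j = a • A₁ v` — to `p`.) [folklore] -/
theorem hcp_twoShell_sites_box {a h : ℝ} (ha : 0 < a) (hlo : 39 / 50 * a ≤ h)
    (hhi : h ≤ 17 / 20 * a) {p : EuclideanSpace ℝ (Fin 3)} (hp : p ∈ hcpStacking a h) :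
    ∃ (A : EuclideanSpace ℝ (Fin 3) →ₗᵢ[ℝ] EuclideanSpace ℝ (Fin 3))
      (site : EuclideanSpace ℝ (Fin 3) → EuclideanSpace ℝ (Fin 3)),
      (∀ v ∈ hcpTwoShellPattern, site v ∈ hcpStacking a h ∧ site v ≠ p ∧
        dist (site v) (p + a • A v) ≤ a / 20) ∧
      Set.InjOn site ↑hcpTwoShellPattern ∧
      (∀ w ∈ hcpStacking a h, w ≠ p → dist w p ≤ 3 / 2 * a →
        ∃ v ∈ hcpTwoShellPattern, w = site v) := by
  classical
  have h0 : 0 < h := lt_of_lt_of_le (by positivity) hlo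
  obtain ⟨hI0, hI2⟩ := ideal_spacing_pos_sq ha
  set hI : ℝ := Real.sqrt (2 / 3) * a with hIdef
  have htol : |h - hI| ≤ a / 20 := abs_sub_ideal_le ha.le hlo hhi
  obtain ⟨B, hB⟩ := hcpStacking_homogeneous a h hp
  -- layer coordinates of a pattern point (junk `(0,0,0)` off the pattern)
  have hcoord : ∀ v : EuclideanSpace ℝ (Fin 3), ∃ q : ℤ × ℤ × ℤ, v ∈ hcpTwoShellPattern →
      q.1 ^ 2 ≤ 1 ∧ a • closePackingFrame 1 (Or.inl rfl) v =
        barlowPos a hI alternatingHagg q.1 q.2.1 q.2.2 := by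
    intro v
    by_cases hv : v ∈ hcpTwoShellPattern
    · have hv' := hv
      rw [hcpTwoShellPattern, scaledPattern, Finset.mem_image] at hv'
      obtain ⟨t, ht, rfl⟩ := hv'
      obtain ⟨k, hk, i, -, j, -, hS, hx, hy⟩ := exists_site_of_mem_hcpTwoShellInt t ht
      exact ⟨(k, i, j), fun _ => ⟨sq_le_one_of_mem_Icc hk,
        smul_closePackingFrame_eq_barlowPos ha hI0 hI2 (sq_le_one_of_mem_Icc hk) hS hx hy⟩⟩
    · exact ⟨(0, 0, 0), fun h' => absurd h' hv⟩
  choose crd hcrd using hcoord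
  set site : EuclideanSpace ℝ (Fin 3) → EuclideanSpace ℝ (Fin 3) := fun v =>
    p + B (barlowPos a h alternatingHagg (crd v).1 (crd v).2.1 (crd v).2.2) with hsite
  refine ⟨B.toLinearIsometry.comp (closePackingFrame 1 (Or.inl rfl)), site, ?_, ?_, ?_⟩
  · intro v hv
    obtain ⟨hk, hframe⟩ := hcrd v hv
    set q : EuclideanSpace ℝ (Fin 3) :=
      barlowPos a h alternatingHagg (crd v).1 (crd v).2.1 (crd v).2.2 with hq
    set qI : EuclideanSpace ℝ (Fin 3) :=
      barlowPos a hI alternatingHagg (crd v).1 (crd v).2.1 (crd v).2.2 with hqI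
    have hqqI : dist q qI ≤ a / 20 := by
      rw [hq, hqI, dist_barlowPos_layer]
      have hk' : |((crd v).1 : ℝ)| ≤ 1 := by
        rw [abs_le]
        obtain ⟨h1, h2⟩ := abs_le_one_of_sq_le_one hk
        exact ⟨by exact_mod_cast h1, by exact_mod_cast h2⟩
      calc |((crd v).1 : ℝ)| * |h - hI| ≤ 1 * |h - hI| :=
            mul_le_mul_of_nonneg_right hk' (abs_nonneg _)
        _ ≤ a / 20 := by rw [one_mul]; exact htol
    have e : a • (B.toLinearIsometry.comp (closePackingFrame 1 (Or.inl rfl))) v = B qI := by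
      rw [← hframe, map_smul]; rfl
    refine ⟨?_, ?_, ?_⟩
    · exact (hB q).1 (barlowPos_mem _ _ _)
    · intro hsv
      have hBq : B q = 0 := by
        have : p + B q = p + 0 := by rw [add_zero]; exact hsv
        exact add_left_cancel this
      have hq0 : q = 0 := (LinearIsometryEquiv.map_eq_zero_iff B).1 hBq
      -- but `q` is within `a/20` of `qI`, which has norm `a` or `√2·a`
      have hnI : a ≤ ‖qI‖ := by
        rw [← hframe]
        rcases norm_smul_frame ha hv with hn | hn
        · rw [hn]
        · rw [hn]
          have : (1 : ℝ) ≤ Real.sqrt 2 := Real.one_le_sqrt.mpr (by norm_num)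
          nlinarith
      have hdI : dist q qI = ‖qI‖ := by rw [hq0, dist_comm, dist_zero_right]
      linarith
    · show dist (p + B q) (p + a • (B.toLinearIsometry.comp (closePackingFrame 1 (Or.inl rfl))) v)
        ≤ a / 20
      rw [e, dist_add_left, LinearIsometryEquiv.dist_map]
      exact hqqI
  · intro v hv v' hv' hvv'
    obtain ⟨-, hframe⟩ := hcrd v hv
    obtain ⟨-, hframe'⟩ := hcrd v' hv'
    have h1 : barlowPos a h alternatingHagg (crd v).1 (crd v).2.1 (crd v).2.2 =
        barlowPos a h alternatingHagg (crd v').1 (crd v').2.1 (crd v').2.2 :=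
      B.injective (add_left_cancel hvv')
    have h2 := barlowPos_injective_coords ha h0 alternatingHagg h1
    simp only [Prod.mk.injEq] at h2
    obtain ⟨h2a, h2b, h2c⟩ := h2
    have h3 : a • closePackingFrame 1 (Or.inl rfl) v = a • closePackingFrame 1 (Or.inl rfl) v' := by
      rw [hframe, hframe', h2a, h2b, h2c]
    exact (closePackingFrame 1 (Or.inl rfl)).injective
      (smul_right_injective (EuclideanSpace ℝ (Fin 3)) ha.ne' h3)
  · intro w hw hwp hd
    set q : EuclideanSpace ℝ (Fin 3) := B.symm (w - p) with hq
    have hwq : w = p + B q := by rw [hq, LinearIsometryEquiv.apply_symm_apply, add_sub_cancel]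
    have hq1 : q ∈ hcpStacking a h := by rw [hB, ← hwq]; exact hw
    have hq0 : q ≠ 0 := by
      intro h0'
      apply hwp
      rw [hwq, h0', map_zero, add_zero]
    have hqn : ‖q‖ ≤ 3 / 2 * a := by
      rw [hq, LinearIsometryEquiv.norm_map, ← dist_eq_norm]; exact hd
    obtain ⟨k, i, j, hqk⟩ := hq1
    have hne : (k, i, j) ≠ (0, 0, 0) := by
      intro heq
      simp only [Prod.mk.injEq] at heq
      obtain ⟨rfl, rfl, rfl⟩ := heq
      exact hq0 (by rw [hqk]; simp [barlowPos])
    rw [hqk] at hqn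
    obtain ⟨hk, t, ht, hS, hx, hy⟩ := exists_hcpTwoShellInt_of_norm_le_box ha hlo hne hqn
    set v : EuclideanSpace ℝ (Fin 3) := (Real.sqrt ((18 : ℕ) : ℝ))⁻¹ • intVec t with hvdef
    have hv : v ∈ hcpTwoShellPattern := by
      rw [hcpTwoShellPattern, scaledPattern]
      exact Finset.mem_image_of_mem _ ht
    have hframe_v : a • closePackingFrame 1 (Or.inl rfl) v = barlowPos a hI alternatingHagg k i j :=
      smul_closePackingFrame_eq_barlowPos ha hI0 hI2 hk hS hx hy
    obtain ⟨-, hframe⟩ := hcrd v hv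
    have h2 := barlowPos_injective_coords ha hI0 alternatingHagg (hframe.symm.trans hframe_v)
    simp only [Prod.mk.injEq] at h2
    obtain ⟨h2a, h2b, h2c⟩ := h2
    refine ⟨v, hv, ?_⟩
    show w = p + B (barlowPos a h alternatingHagg (crd v).1 (crd v).2.1 (crd v).2.2)
    rw [h2a, h2b, h2c, ← hqk, ← hwq]

/-! ## §8 A fully surrounded particle of the relaxed stacking is `1/20`-good -/

/-- **Goodness of a fully surrounded particle of the relaxed hcp stacking.**  If the particles sit
on `hcpStacking a h` (`a ∈ [47/50, 1]`, `h ∈ [39a/50, 17a/20]`, distinct) and, for a frame `A` and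
site map `site` as in `hcp_twoShell_sites_box`, all eighteen sites of particle `i` are occupied,
then `i` is `1/20`-good: an `a/20`-match at scale `a` with the isometry `A` and the hcp pattern; the
two-way clause holds because the stacking points within `3a/2` of `x i` are sites. [folklore] -/
theorem good_of_sites_occupied_hcp_box {a h : ℝ} (h47 : 47 / 50 ≤ a) (h1 : a ≤ 1) {N : ℕ}
    {x : Fin N → EuclideanSpace ℝ (Fin 3)} (hx : Function.Injective x)
    (hL : ∀ j, x j ∈ hcpStacking a h) (i : Fin N)
    (A : EuclideanSpace ℝ (Fin 3) →ₗᵢ[ℝ] EuclideanSpace ℝ (Fin 3))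
    (site : EuclideanSpace ℝ (Fin 3) → EuclideanSpace ℝ (Fin 3))
    (hA1 : ∀ v ∈ hcpTwoShellPattern, site v ≠ x i ∧ dist (site v) (x i + a • A v) ≤ a / 20)
    (hinj : Set.InjOn site ↑hcpTwoShellPattern)
    (hA2 : ∀ w ∈ hcpStacking a h, w ≠ x i → dist w (x i) ≤ 3 / 2 * a →
      ∃ v ∈ hcpTwoShellPattern, w = site v)
    (hocc : ∀ v ∈ hcpTwoShellPattern, ∃ j, x j = site v) :
    IsTwoShellGood (1 / 20) (47 / 50) 1 x i := by
  classical
  -- the assignment: the occupant of the site, if any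
  let f : EuclideanSpace ℝ (Fin 3) → Fin N := fun w =>
    if h : ∃ j, x j = site w then h.choose else i
  have hf : ∀ w : EuclideanSpace ℝ (Fin 3), ∀ j, x j = site w → f w = j ∧ x (f w) = site w := by
    intro w j hj
    have hex : ∃ j, x j = site w := ⟨j, hj⟩
    have hfw : f w = hex.choose := dif_pos hex
    have hspec : x hex.choose = site w := hex.choose_spec
    refine ⟨?_, by rw [hfw]; exact hspec⟩
    rw [hfw]
    exact hx (hspec.trans hj.symm)
  refine ⟨a, h47, h1, A, hcpTwoShellPattern, f, Or.inr rfl, ?_, ?_, ?_⟩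
  · -- every pattern point is matched, within `a/20`, by a particle other than `i`
    intro v hv
    obtain ⟨j, hj⟩ := hocc v hv
    obtain ⟨hfj, hxf⟩ := hf v j hj
    refine ⟨?_, ?_⟩
    · intro hfi
      have : site v = x i := by rw [← hxf, hfi]
      exact (hA1 v hv).1 this
    · rw [hxf, show (1 / 20 : ℝ) * a = a / 20 by ring]
      exact (hA1 v hv).2
  · -- injectivity on the pattern
    intro v hv v' hv' hvv'
    obtain ⟨j, hj⟩ := hocc v hv
    obtain ⟨j', hj'⟩ := hocc v' hv'
    have e1 := (hf v j hj).2
    have e2 := (hf v' j' hj').2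
    have : site v = site v' := by rw [← e1, ← e2, hvv']
    exact hinj hv hv' this
  · -- two-way: every particle within `3a/2` is a site occupant
    intro j hji hd
    have hne : x j ≠ x i := fun h => hji (hx h)
    obtain ⟨v, hv, hv'⟩ := hA2 (x j) (hL j) hne hd
    exact ⟨v, hv, (hf v j hv').1⟩

/-- **A bad particle of the relaxed hcp stacking has a vacant stacking site within
`(1/20 + √2)·a`** (`a ∈ [47/50, 1]`, `h ∈ [39a/50, 17a/20]`, distinct particles): the vacant
two-shell site of `hcp_twoShell_sites_box`, `a/20`-close to an ideal site of norm `a` or `√2·a`.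
[folklore] -/
theorem exists_vacant_site_of_bad_hcp_box {a h : ℝ} (h47 : 47 / 50 ≤ a) (h1 : a ≤ 1)
    (hlo : 39 / 50 * a ≤ h) (hhi : h ≤ 17 / 20 * a) {N : ℕ} {x : Fin N → EuclideanSpace ℝ (Fin 3)}
    (hx : Function.Injective x) (hL : ∀ j, x j ∈ hcpStacking a h) (i : Fin N)
    (hbad : ¬ IsTwoShellGood (1 / 20) (47 / 50) 1 x i) :
    ∃ w ∈ hcpStacking a h, w ∉ Set.range x ∧ dist w (x i) ≤ (1 / 20 + Real.sqrt 2) * a := by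
  have ha : 0 < a := by linarith
  obtain ⟨A, site, hA1, hinj, hA2⟩ := hcp_twoShell_sites_box ha hlo hhi (hL i)
  by_contra hcon
  push Not at hcon
  refine hbad (good_of_sites_occupied_hcp_box h47 h1 hx hL i A site
    (fun v hv => ⟨(hA1 v hv).2.1, (hA1 v hv).2.2⟩) hinj hA2 ?_)
  intro v hv
  obtain ⟨hmem, -, hclose⟩ := hA1 v hv
  by_contra hno
  push Not at hno
  have hrange : site v ∉ Set.range x := by
    rintro ⟨j, hj⟩
    exact hno j hj
  have hfar := hcon _ hmem hrange
  -- `dist (site v) (x i) ≤ a/20 + ‖a • A v‖ ≤ a/20 + √2·a`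
  have hnorm : ‖a • A v‖ ≤ Real.sqrt 2 * a := by
    rw [norm_smul, LinearIsometry.norm_map, Real.norm_of_nonneg ha.le]
    have h2 : (1 : ℝ) ≤ Real.sqrt 2 := Real.one_le_sqrt.mpr (by norm_num)
    rcases norm_of_mem_hcpTwoShellPattern hv with hn | hn
    · rw [hn]; nlinarith
    · rw [hn, mul_comm]
  have htri : dist (site v) (x i) ≤ dist (site v) (x i + a • A v) + dist (x i + a • A v) (x i) :=
    dist_triangle _ _ _
  rw [dist_comm (x i + a • A v) (x i), dist_self_add_right] at htri
  have : dist (site v) (x i) ≤ (1 / 20 + Real.sqrt 2) * a := by nlinarith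
  linarith

/-- **Registered sub-goal `stub_hcpBoxShell` of the crux item** (line `Sketch`, continuation lead
c2): RELAXED hcp — a bad particle of a sub-configuration of `hcpStacking a h`, `a ∈ [47/50, 1]`,
`h ∈ [39a/50, 17a/20]`, has a vacant stacking site within `(1/20 + √2)·a`
(`exists_vacant_site_of_bad_hcp_box`, quantified form). [folklore] -/
theorem stub_hcpBoxShell :
    ∀ a h : ℝ, 47 / 50 ≤ a → a ≤ 1 → 39 / 50 * a ≤ h → h ≤ 17 / 20 * a →
    ∀ (N : ℕ) (x : Fin N → EuclideanSpace ℝ (Fin 3)), Function.Injective x →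
      (∀ j : Fin N, x j ∈ hcpStacking a h) →
      ∀ i : Fin N, ¬ IsTwoShellGood (1 / 20) (47 / 50) 1 x i →
      ∃ w ∈ hcpStacking a h, w ∉ Set.range x ∧ dist w (x i) ≤ (1 / 20 + Real.sqrt 2) * a :=
  fun _ _ h47 h1 hlo hhi _ _ hx hL i hbad => exists_vacant_site_of_bad_hcp_box h47 h1 hlo hhi hx hL i hbad

end Summit.AtomisticToContinuum.Crystallization.Theorems.PhononSlackCertificatesNearFarGlueR

end
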